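/-
Origin: expansion seat `planner-pub-hodgecm-mc-glue-1-0`, handover #28 2026-08-18T19:00Z md5 a0fa4b4ac02a4149b40c5f6ecf3f1c10 (NEW additive leaf, 155 l., junction J3; PKG CLAIM window -> 19:10Z; INSTALL ONLY WITH/AFTER packet-1 rows #25-#26 (needs vendored Weil1964.ThetaKernelDualPair); imports HodgeCM.Automorphic.WeilThetaModel + HodgeCM.Vendored.H21.NumberTheory.Weil1964.ThetaKernelDualPair; nothing landed imports it; as-landed rehearsal rc 0, 0 errors, 0 warni (`HOME/mc/pub-hodgecm-mc-glue-1/aslanded/HodgeCM/Model/Junction/ThetaKernelDatumToPkg.lean`, md5 a0fa4b4a, 155 lines);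
landed by the packager successor (mc-unitary-1-g3, gen-8 kit) in gate run 32 as `HodgeCM/Model/Junction/ThetaKernelDatumToPkg.lean` (verbatim).
-/
/-
Origin: speedrun cell pub-hodgecm, MODEL-CONSTRUCTION sub-cell, unit pub-hodgecm-mc-glue-1 (node E-J, junction J3
of E2-INSTANCE-SPEC-prl1 §3), seat planner-pub-hodgecm-mc-glue-1-0, 2026-08-18.
Target in PKG: HodgeCM/Model/Junction/ThetaKernelDatumToPkg.lean (NEW additive leaf; nothing landed imports it).
P0 NOTE: the second import is the harness-tree module `Literature.NumberTheory.Weil1964.ThetaKernelDualPair`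
(mc-theta-2, W6a-4, p177792); after vendoring it reads
`import HodgeCM.Vendored.H21.NumberTheory.Weil1964.ThetaKernelDualPair` (same declarations, namespace
`Literature.NumberTheory.Weil1964`, unchanged).
-/
import Summits.HodgeConjecture.HodgeCM.Automorphic.WeilThetaModel
import Literature.NumberTheory.Weil1964.ThetaKernelDualPair

/-!
# Junction J3: tree `ThetaKernelDatum` ↦ package `WeilThetaModel`

The harness tree's theta side (mc-theta-2, `Literature.NumberTheory.Weil1964.ThetaKernelDualPair`) produces an
UNBUNDLED `ThetaKernelDatum Mp SX GU ΓU G Γ` over an unbundled Weil datum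
`Literature.NumberTheory.Weil1964.WeilThetaDatum Mp SX`; the package's sign-recipe end state consumes a
`HodgeCM.WeilThetaModel GU ΓU G Γ` whose Weil datum `HodgeCM.Literature.Theta.WeilThetaDatum.{0}` BUNDLES the
carriers `Mp`, `SX` with their instances.  The two structures have the same fields with the same bodies
(`ThetaKernelDualPair.lean` ll. 96–121 vs `WeilThetaModel.lean` ll. 89–115), and the two PRINT props
`ActionContinuous` / `ThetaContinuousInvariant` have literally the same bodies on both sides
(`ThetaDistribution.lean` ll. 69, 80 vs `HodgeCM/Literature/WeilTheta1964.lean` ll. 76, 97).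

This file is the repackaging, with every transfer lemma closed by `rfl` / `Iff.rfl`:
* `WeilThetaDatum.toPkg` (bundle the carriers; universe 0) and the two `Iff.rfl` transfers of the print props;
* `ThetaKernelDatum.toPkg : ThetaKernelDatum Mp SX GU ΓU G Γ → HodgeCM.WeilThetaModel GU ΓU G Γ` (fields copied);
* the derived objects agree definitionally: `omg`, `thetaFun`, `thetaQuot`, `θ` (`toPkg_θ : M.toPkg.θ = M.θ` up
  to the identity `M.SK = M.toPkg.SK`), so every structural law / vanishing statement proved tree-side about
  `M.θ` is available verbatim for `M.toPkg.θ`.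

Deliberate dot-notation extensions: the declarations live in the (vendored) tree namespaces
`Literature.NumberTheory.Weil1964.WeilThetaDatum` / `.ThetaKernelDatum` so that `D.toPkg`, `M.toPkg` resolve by
dot notation; no declaration of these names exists in the tree or the package (checked 2026-08-18).
No cited fact, no hypothesis beyond the data: 0 MODEL-N.
-/

set_option autoImplicit false

noncomputable section

open Topology

namespace Literature.NumberTheory.Weil1964

/-! ## 1. The Weil datum: unbundled ↦ bundled -/

namespace WeilThetaDatum

variable {Mp SX : Type} [TopologicalSpace Mp] [Group Mp] [TopologicalSpace SX]
variable (D : WeilThetaDatum Mp SX)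

/-- **J3a.** Bundle the carriers of a tree Weil datum into the package's `WeilThetaDatum.{0}` (the instances
on `Mp`, `SX` are the ambient ones). -/
def toPkg : HodgeCM.Literature.Theta.WeilThetaDatum.{0} :=
  { Mp := Mp, SX := SX, act := D.act, rat := D.rat, theta := D.theta }

/-- (Ported verbatim from the HodgeCMPerL package; no docstring in the source.) -/
@[simp] theorem toPkg_Mp : D.toPkg.Mp = Mp := rfl

/-- (Ported verbatim from the HodgeCMPerL package; no docstring in the source.) -/
@[simp] theorem toPkg_SX : D.toPkg.SX = SX := rfl

/-- (Ported verbatim from the HodgeCMPerL package; no docstring in the source.) -/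
theorem toPkg_act : D.toPkg.act = D.act := rfl

/-- (Ported verbatim from the HodgeCMPerL package; no docstring in the source.) -/
theorem toPkg_rat : D.toPkg.rat = D.rat := rfl

/-- (Ported verbatim from the HodgeCMPerL package; no docstring in the source.) -/
theorem toPkg_theta : D.toPkg.theta = D.theta := rfl

/-- [Weil1964, n° 39] transfers by `Iff.rfl` (same body on both sides). -/
theorem actionContinuous_toPkg_iff : D.toPkg.ActionContinuous ↔ D.ActionContinuous := Iff.rfl

/-- [Weil1964, n° 41 Théorème 6] transfers by `Iff.rfl` (same body on both sides). -/
theorem thetaContinuousInvariant_toPkg_iff :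
    D.toPkg.ThetaContinuousInvariant ↔ D.ThetaContinuousInvariant := Iff.rfl

end WeilThetaDatum

/-! ## 2. The theta-kernel datum ↦ the package's Weil theta model -/

namespace ThetaKernelDatum

variable {Mp SX : Type} [TopologicalSpace Mp] [Group Mp] [TopologicalSpace SX]
variable {GU : Type} [Group GU] [TopologicalSpace GU] {ΓU : Subgroup GU}
variable {G : Type} [Group G] [TopologicalSpace G] {Γ : Subgroup G}
variable (M : ThetaKernelDatum Mp SX GU ΓU G Γ)

/-- **J3.** A tree theta-kernel datum IS a package Weil theta model (fields copied verbatim; the two PRINT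
props and `dist_cont` ride along unchanged). -/
def toPkg : HodgeCM.WeilThetaModel GU ΓU G Γ where
  W := M.W.toPkg
  act_one := M.act_one
  theta_act := M.theta_act
  actionContinuous := M.actionContinuous
  thetaContinuousInvariant := M.thetaContinuousInvariant
  dist_cont := M.dist_cont
  s := M.s
  s_cont := M.s_cont
  s_rat := M.s_rat
  SK := M.SK
  SK_stable := M.SK_stable

/-- (Ported verbatim from the HodgeCMPerL package; no docstring in the source.) -/
@[simp] theorem toPkg_W : M.toPkg.W = M.W.toPkg := rfl

/-- (Ported verbatim from the HodgeCMPerL package; no docstring in the source.) -/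
@[simp] theorem toPkg_s : M.toPkg.s = M.s := rfl

/-- (Ported verbatim from the HodgeCMPerL package; no docstring in the source.) -/
@[simp] theorem toPkg_SK : M.toPkg.SK = M.SK := rfl

/-- The index types coincide (`M.toPkg.SK = M.SK` as sets of `SX`); the identity between the subtypes. -/
def skEquiv : M.SK ≃ M.toPkg.SK := Equiv.refl _

/-- Underlying elements are unchanged (both sides live in `SX`; the package sees it as `M.toPkg.W.SX`). -/
@[simp] theorem val_skEquiv (Φ : M.SK) : (M.skEquiv Φ).1 = Φ.1 := rfl

/-- (Ported verbatim from the HodgeCMPerL package; no docstring in the source.) -/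
@[simp] theorem val_skEquiv_symm (Φ : M.toPkg.SK) : (M.skEquiv.symm Φ).1 = Φ.1 := rfl

/-- `ω(h)` agrees. -/
theorem toPkg_omg (h : G) (Φ : M.SK) : M.toPkg.omg h (M.skEquiv Φ) = M.skEquiv (M.omg h Φ) := rfl

/-- (Ported verbatim from the HodgeCMPerL package; no docstring in the source.) -/
theorem val_toPkg_omg (h : G) (Φ : M.toPkg.SK) :
    (M.toPkg.omg h Φ).1 = M.W.act (M.s (1, h)) Φ.1 := rfl

/-- The kernel upstairs agrees. -/
@[simp] theorem toPkg_thetaFun (Φ : SX) (p : GU × G) : M.toPkg.thetaFun Φ p = M.thetaFun Φ p := rfl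

/-- The descended kernel agrees. -/
@[simp] theorem toPkg_thetaQuot (Φ : SX) : M.toPkg.thetaQuot Φ = M.thetaQuot Φ := by
  funext q
  obtain ⟨ξ, q⟩ := q
  induction ξ using QuotientGroup.induction_on with
  | H x =>
    induction q using QuotientGroup.induction_on with
    | H y => rfl

variable [IsTopologicalGroup GU] [IsTopologicalGroup G]

/-- The dictionary on representatives, package side. -/
theorem toPkg_θ_mk (Φ : M.toPkg.SK) (x : GU) (y : G) :
    M.toPkg.θ Φ (QuotientGroup.mk x, QuotientGroup.mk y) = M.W.theta Φ.1 (M.s (x, y)⁻¹) := rfl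

/-- **The theta kernels agree**: `θ^{pkg}_Φ = θ^{tree}_Φ` as continuous maps on `(GU ⧸ ΓU) × (G ⧸ Γ)`. -/
@[simp] theorem toPkg_θ (Φ : M.SK) : M.toPkg.θ (M.skEquiv Φ) = M.θ Φ := by
  ext q
  rw [HodgeCM.WeilThetaModel.θ_apply, θ_apply]
  exact congrFun (M.toPkg_thetaQuot Φ.1) q

/-- (Ported verbatim from the HodgeCMPerL package; no docstring in the source.) -/
theorem toPkg_θ' (Φ : M.toPkg.SK) : M.toPkg.θ Φ = M.θ (M.skEquiv.symm Φ) :=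
  M.toPkg_θ (M.skEquiv.symm Φ)

/-- The family `Φ ↦ θ_Φ` agrees as a map (for continuity statements such as `θ_cont`). -/
theorem toPkg_θ_comp : M.toPkg.θ ∘ M.skEquiv = M.θ := funext M.toPkg_θ

end ThetaKernelDatum

end Literature.NumberTheory.Weil1964

end
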